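import Literature.NumberTheory.IwasawaTheory.ClassNumberPExpSuccEqOfCardFixedLeTrivialBase
import Literature.NumberTheory.IwasawaTheory.ClassicalMuVanishesUnitNormIndexAnyPrime
import Literature.NumberTheory.NumberFields.QuadraticExtensionOddClassNumberTwoNonNormUnits
import HarnessLib

/-!
# Door UG WITHOUT the generation hypothesis over a base with `p ∤ h_K` — the tower: the unit norm index of ONE layer
# `K_{n+1}/K_n` gives `e_{n+1} = e_n`, then `e_m = e_n` for all `m ≥ n`, `μ = 0`, `λ = 0` (every prime; `p = 2` with explicit non-norm units)

Topic `NumberTheory/IwasawaTheory` (namespace = path).  THEOREMS ONLY (no definition, no named fact, no instance, no `sorry`).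
Sequel of `ClassNumberPExpSuccEqOfCardFixedLeTrivialBase.lean` (the layer step: `p ∤ h_K`, `N : Cl(K_{n+1}) ↠ Cl(K_n)` and
`#Cl(K_{n+1})^G ≤ h(K_n)` ⟹ `ord_p h(K_{n+1}) = ord_p h(K_n)`) and of `ClassicalMuVanishesUnitNormIndexAnyPrime.lean` (att-p3 g38: the
same doors WITH the generation hypothesis `hgen`, any `h_K`).  Here Chevalley's formula supplies `#Cl(K_{n+1})^G ∣ h(K_n)` from at most `s`
ramified primes and `p^{s-1} ∣ [E_{K_n} : E_{K_n} ∩ N K_{n+1}ˣ]` (`AmbiguousClass.card_fixed_dvd_classNumber_of_pow_dvd_relIndex_mul`; the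
layers of a `ℤ_p`-tower are unramified at infinity for every `p`), a totally ramified prime above Fukuda's index makes the norm onto
(`classGroupNorm_layer_succ_surjective`), and Fukuda's Thm. 1 (1) (tree theorem) propagates `e_{n+1} = e_n` up the tower.  So, over a
base with `p ∤ h_K`, the door needs NO class-group datum of any layer: only units.

## Main results (`κ` a `ℤ_p`-extension of `K` with `p ∤ h_K`, `TotallyRamifiedFrom κ n₀`, `n₀ ≤ n`)

* ★★ `classNumberPExp_succ_eq_of_pow_dvd_relIndex_mul_of_not_dvd` — at most `s` primes of `K_n` ramified in `K_{n+1}` and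
  `p^s ∣ [E_{K_n} : E_{K_n} ∩ N K_{n+1}ˣ] · p` ⟹ `e_{n+1} = e_n`;
* `classNumberPExp_eq_of_le_of_pow_dvd_relIndex_mul_of_not_dvd` (`e_m = e_n`, `m ≥ n`), `classicalMuVanishes_of_pow_dvd_relIndex_mul_of_not_dvd`
  (`μ = 0`), `classicalLambda_eq_zero_of_pow_dvd_relIndex_mul_of_not_dvd` (`λ = 0`);
* `p = 2` consumer forms with EXPLICIT non-norm units of `K_n` (tree `two_dvd_relIndex_unitsNorm_of_not_mem`,
  `four_dvd_relIndex_unitsNorm_of_not_mem`): ONE unit / at most two ramified primes (`…_two_of_nonNorm_unit_of_not_dvd`), TWO units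
  `x, y` with `x, y, xy ∉ N K_{n+1}ˣ` / at most three ramified primes (`…_two_of_two_nonNorm_units_of_not_dvd`).

USE (cell bsd-f1-sign2, crux C2; cubic fields `F` with `h_F` odd): on the stratum where `2 = 𝔭₁𝔭₂` in `F` (two primes above `2` in every
layer, both totally ramified) ONE unit of the layer `F_n` with a certified non-norm dyadic residue (tree `QuadraticNonNormUnitDyadicIdeal`)
gives `μ₂ = λ₂ = 0` with no class group of `F_n` or `F_{n+1}`.  On the stratum where `2` splits completely the `2`-class numbers grow
strictly (Summits `…CubicTowerGrowth`), so the two-unit hypothesis is never met there.  HONEST SCOPE: classical genus theory + Fukuda;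
nothing specific to any summit; BSD is not advanced by this file.

## References

* S. Lang, *Cyclotomic Fields I and II*, GTM 121 (1990), Ch. 13 §4, Lemma 4.1–4.2 and sequel (PDF pp. 203–204). [Lang1990]
* L. C. Washington, *Introduction to Cyclotomic Fields*, 2nd ed., GTM 83 (1997), §13.1 Prop. 13.2, §13.3 Prop. 13.22. [Washington1997]
* T. Fukuda, *Remarks on `ℤ_p`-extensions of number fields*, Proc. Japan Acad. 70 A (1994), Thm. 1 (1), p. 264. [Fukuda1994]
* G. Gras, *Class Field Theory* (2003), II.6.2.3, IV.4 (genus theory). [Gras2003]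
-/

noncomputable section

open NumberField IsDedekindDomain Field
open scoped nonZeroDivisors

namespace Literature.NumberTheory.IwasawaTheory

open Literature.NumberTheory.EllipticCurves Literature.NumberTheory.NumberFields
  Literature.NumberTheory.NumberFields.AmbiguousClass
  Literature.NumberTheory.GaloisRepresentations Literature.NumberTheory.GaloisRepresentations.Herbrand
  Literature.NumberTheory.GaloisRepresentations.MinkowskiUnit
  Literature.NumberTheory.GaloisRepresentations.CyclicNormIndex

/-! ## §2 The tower: `e_{n+1} = e_n` from the unit norm index of ONE layer, then every later layer (Fukuda, proved) -/

section Tower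

variable {K : Type} [Field K] [NumberField K] {p : ℕ} [hp : Fact p.Prime] (κ : ZpExtension K p)

/-- ★★ **Door UG without the generation hypothesis, every prime `p`: `e_{n+1} = e_n` from the unit norm index of the layer
`K_{n+1}/K_n` over a base with `p ∤ h_K`.**  `κ` a `ℤ_p`-extension of `K` with `p ∤ h_K` and Fukuda's index `n₀ ≤ n`
(`TotallyRamifiedFrom κ n₀`); `K_{n+1}` a `K_n`-algebra compatibly with `K`.  If at most `s` primes of `K_n` ramify in `K_{n+1}` and
`p^s ∣ [E_{K_n} : E_{K_n} ∩ N K_{n+1}ˣ] · p` (unit norm index divisible by `p^{s-1}`), then `ord_p h(K_{n+1}) = ord_p h(K_n)`.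
(`K_{n+1}/K_n` is Galois of degree `p`, unramified at infinity for every `p`; Chevalley gives `#Cl(K_{n+1})^G ∣ h(K_n)`
(`card_fixed_dvd_classNumber_of_pow_dvd_relIndex_mul`); the norm is onto (`classGroupNorm_layer_succ_surjective`); then
`padicValNat_classNumber_layer_succ_eq_of_card_fixed_le`.)  Compare `classNumberPExp_succ_eq_of_pow_dvd_of_sup_eq_top`, which
needs the ramified classes to generate `Cl(K_n)/p` but no hypothesis on `h_K`.
[cite: Lang1990, Ch. 13 §4, Lemma 4.1–4.2 and sequel (PDF pp. 203–204)] [cite: Washington1997, §13.3 Prop. 13.22 (proof)] -/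
theorem classNumberPExp_succ_eq_of_pow_dvd_relIndex_mul_of_not_dvd {n₀ : ℕ} (hram : TotallyRamifiedFrom κ n₀)
    (hK : ¬ p ∣ classNumber K) (n : ℕ) (hn : n₀ ≤ n)
    [NumberField (κ.layer n)] [Algebra (κ.layer n) (κ.layer (n + 1))]
    [IsScalarTower K (κ.layer n) (κ.layer (n + 1))]
    [FiniteDimensional K (κ.layer (n + 1))] [FiniteDimensional (κ.layer n) (κ.layer (n + 1))] {s : ℕ}
    (hs : {w : HeightOneSpectrum (𝓞 (κ.layer n)) |
        w.asIdeal.ramificationIdxIn (𝓞 (κ.layer (n + 1))) ≠ 1}.ncard ≤ s)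
    (hidx : p ^ s ∣ (unitsE (κ.layer (n + 1)) ⊓ (⊤ : Subgroup (κ.layer (n + 1))ˣ).map
          (Herbrand.norm (κ.layer (n + 1) ≃ₐ[κ.layer n] κ.layer (n + 1)))).relIndex
        (unitsE (κ.layer (n + 1)) ⊓ (unitsIncl (κ.layer n) (κ.layer (n + 1))).range) * p) :
    classNumberPExp κ (n + 1) = classNumberPExp κ n := by
  haveI : FiniteDimensional K (κ.layer n) := κ.finiteDimensional_layer_holds n
  haveI : IsGalois K (κ.layer (n + 1)) := κ.isGalois_layer_holds (n + 1)
  haveI : IsGalois (κ.layer n) (κ.layer (n + 1)) := IsGalois.tower_top_of_isGalois K _ _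
  haveI : NumberField (κ.layer (n + 1)) := NumberField.of_module_finite K (κ.layer (n + 1))
  haveI : Module.Free (κ.layer n) (κ.layer (n + 1)) := Module.Free.of_divisionRing _ _
  haveI : IsUnramifiedAtInfinitePlaces (κ.layer n) (κ.layer (n + 1)) :=
    isUnramifiedAtInfinitePlaces_layer_layer κ n (n + 1)
  have hpr : p.Prime := hp.out
  have hdeg : Module.finrank (κ.layer n) (κ.layer (n + 1)) = p := by
    have h := Module.finrank_mul_finrank K (κ.layer n) (κ.layer (n + 1))
    rw [κ.finrank_layer_holds n, κ.finrank_layer_holds (n + 1), pow_succ] at h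
    exact Nat.eq_of_mul_eq_mul_left (pow_pos hpr.pos n) h
  have hfix := card_fixed_dvd_classNumber_of_pow_dvd_relIndex_mul hpr hdeg hs hidx
  rw [classNumberPExp_eq_padicValNat_classNumber, classNumberPExp_eq_padicValNat_classNumber]
  refine padicValNat_classNumber_layer_succ_eq_of_card_fixed_le κ n hK
    (classGroupNorm_layer_succ_surjective κ n hram hn) (Nat.le_of_dvd ?_ hfix)
  rw [classNumber]; exact Fintype.card_pos

/-- **Along the tower: `e_m = e_n` for all `m ≥ n`** (unconditional).  Under the hypotheses of
`classNumberPExp_succ_eq_of_pow_dvd_relIndex_mul_of_not_dvd` (`p ∤ h_K`, Fukuda's index `n₀ ≤ n`, the unit norm index of the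
layer `K_{n+1}/K_n`), the `p`-class numbers are constant from `K_n` on — `e_{n+1} = e_n`, then Fukuda's Thm. 1 (1), a tree THEOREM
(`fukuda1994_thm1_classNumberPExp_const_of_succ_eq_holds`). [cite: Fukuda1994, Thm. 1 (1), p. 264]
[cite: Lang1990, Ch. 13 §4, Lemma 4.1–4.2 and sequel (PDF pp. 203–204)] -/
theorem classNumberPExp_eq_of_le_of_pow_dvd_relIndex_mul_of_not_dvd {n₀ : ℕ} (hram : TotallyRamifiedFrom κ n₀)
    (hK : ¬ p ∣ classNumber K) (n : ℕ) (hn : n₀ ≤ n)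
    [NumberField (κ.layer n)] [Algebra (κ.layer n) (κ.layer (n + 1))]
    [IsScalarTower K (κ.layer n) (κ.layer (n + 1))]
    [FiniteDimensional K (κ.layer (n + 1))] [FiniteDimensional (κ.layer n) (κ.layer (n + 1))] {s : ℕ}
    (hs : {w : HeightOneSpectrum (𝓞 (κ.layer n)) |
        w.asIdeal.ramificationIdxIn (𝓞 (κ.layer (n + 1))) ≠ 1}.ncard ≤ s)
    (hidx : p ^ s ∣ (unitsE (κ.layer (n + 1)) ⊓ (⊤ : Subgroup (κ.layer (n + 1))ˣ).map
          (Herbrand.norm (κ.layer (n + 1) ≃ₐ[κ.layer n] κ.layer (n + 1)))).relIndex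
        (unitsE (κ.layer (n + 1)) ⊓ (unitsIncl (κ.layer n) (κ.layer (n + 1))).range) * p)
    {m : ℕ} (hm : n ≤ m) : classNumberPExp κ m = classNumberPExp κ n :=
  fukuda1994_thm1_classNumberPExp_const_of_succ_eq_holds K p κ n₀ hram n hn
    (classNumberPExp_succ_eq_of_pow_dvd_relIndex_mul_of_not_dvd κ hram hK n hn hs hidx) m hm

/-- **`μ = 0` in growth form** (`λ = 0`, `ν = e_n`, threshold `n`) for a `ℤ_p`-extension over a base with `p ∤ h_K`, Fukuda's
index `n₀ ≤ n`, and the unit norm index of the single layer `K_{n+1}/K_n` divisible by `p^{s-1}` (at most `s` ramified primes) —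
no class group of any layer is an input. [cite: Fukuda1994, Thm. 1 (1), p. 264]
[cite: Lang1990, Ch. 13 §4, Lemma 4.1–4.2 and sequel (PDF pp. 203–204)] -/
theorem classicalMuVanishes_of_pow_dvd_relIndex_mul_of_not_dvd {n₀ : ℕ} (hram : TotallyRamifiedFrom κ n₀)
    (hK : ¬ p ∣ classNumber K) (n : ℕ) (hn : n₀ ≤ n)
    [NumberField (κ.layer n)] [Algebra (κ.layer n) (κ.layer (n + 1))]
    [IsScalarTower K (κ.layer n) (κ.layer (n + 1))]
    [FiniteDimensional K (κ.layer (n + 1))] [FiniteDimensional (κ.layer n) (κ.layer (n + 1))] {s : ℕ}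
    (hs : {w : HeightOneSpectrum (𝓞 (κ.layer n)) |
        w.asIdeal.ramificationIdxIn (𝓞 (κ.layer (n + 1))) ≠ 1}.ncard ≤ s)
    (hidx : p ^ s ∣ (unitsE (κ.layer (n + 1)) ⊓ (⊤ : Subgroup (κ.layer (n + 1))ˣ).map
          (Herbrand.norm (κ.layer (n + 1) ≃ₐ[κ.layer n] κ.layer (n + 1)))).relIndex
        (unitsE (κ.layer (n + 1)) ⊓ (unitsIncl (κ.layer n) (κ.layer (n + 1))).range) * p) :
    ClassicalMuVanishes κ :=
  classicalMuVanishes_of_eventually_const κ (c := classNumberPExp κ n) (n₀ := n)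
    fun _ hm => classNumberPExp_eq_of_le_of_pow_dvd_relIndex_mul_of_not_dvd κ hram hK n hn hs hidx hm

/-- Corollary: under the same hypotheses the classical `λ`-invariant vanishes, `classicalLambda κ = 0`.
[cite: Fukuda1994, Thm. 1 (1), p. 264 («μ_p(K/k) = λ_p(K/k) = 0»)] -/
theorem classicalLambda_eq_zero_of_pow_dvd_relIndex_mul_of_not_dvd {n₀ : ℕ} (hram : TotallyRamifiedFrom κ n₀)
    (hK : ¬ p ∣ classNumber K) (n : ℕ) (hn : n₀ ≤ n)
    [NumberField (κ.layer n)] [Algebra (κ.layer n) (κ.layer (n + 1))]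
    [IsScalarTower K (κ.layer n) (κ.layer (n + 1))]
    [FiniteDimensional K (κ.layer (n + 1))] [FiniteDimensional (κ.layer n) (κ.layer (n + 1))] {s : ℕ}
    (hs : {w : HeightOneSpectrum (𝓞 (κ.layer n)) |
        w.asIdeal.ramificationIdxIn (𝓞 (κ.layer (n + 1))) ≠ 1}.ncard ≤ s)
    (hidx : p ^ s ∣ (unitsE (κ.layer (n + 1)) ⊓ (⊤ : Subgroup (κ.layer (n + 1))ˣ).map
          (Herbrand.norm (κ.layer (n + 1) ≃ₐ[κ.layer n] κ.layer (n + 1)))).relIndex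
        (unitsE (κ.layer (n + 1)) ⊓ (unitsIncl (κ.layer n) (κ.layer (n + 1))).range) * p) :
    classicalLambda κ = 0 :=
  classicalLambda_eq_zero_of_eventually_const κ (c := classNumberPExp κ n) (n₀ := n)
    fun _ hm => classNumberPExp_eq_of_le_of_pow_dvd_relIndex_mul_of_not_dvd κ hram hK n hn hs hidx hm

end Tower

/-! ## §3 `p = 2`: the doors from EXPLICIT non-norm units of `K_n`, over a base with `2 ∤ h_K` -/

section Two

variable {K : Type} [Field K] [NumberField K] (κ : ZpExtension K 2) (n : ℕ)
  [Algebra (κ.layer n) (κ.layer (n + 1))] [IsScalarTower K (κ.layer n) (κ.layer (n + 1))]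

/-- `[K_{n+1} : K_n] = 2` for a `ℤ₂`-extension (tower law). [cite: Washington1997, §13.1 (`[K_n : K] = pⁿ`)] -/
private theorem finrank_layer_succ_two : Module.finrank (κ.layer n) (κ.layer (n + 1)) = 2 := by
  haveI : FiniteDimensional K (κ.layer n) := κ.finiteDimensional_layer_holds n
  haveI : FiniteDimensional K (κ.layer (n + 1)) := κ.finiteDimensional_layer_holds (n + 1)
  haveI : Module.Free (κ.layer n) (κ.layer (n + 1)) := Module.Free.of_divisionRing _ _
  have h := Module.finrank_mul_finrank K (κ.layer n) (κ.layer (n + 1))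
  rw [κ.finrank_layer_holds n, κ.finrank_layer_holds (n + 1), pow_succ] at h
  exact Nat.eq_of_mul_eq_mul_left (pow_pos Nat.prime_two.pos n) h

variable {n₀ : ℕ} (hram : TotallyRamifiedFrom κ n₀) (hK : ¬ 2 ∣ classNumber K) (hn : n₀ ≤ n)
  [NumberField (κ.layer n)] [FiniteDimensional K (κ.layer (n + 1))] [FiniteDimensional (κ.layer n) (κ.layer (n + 1))]

include hram hK hn

/-- **`p = 2`, ONE non-norm unit: `e_{n+1} = e_n`** (unconditional).  `κ` a `ℤ₂`-extension of `K` with `2 ∤ h_K` and Fukuda's index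
`n₀ ≤ n`; if at most TWO primes of `K_n` ramify in `K_{n+1}` and some unit `x` of `K_n` is not a norm from `K_{n+1}ˣ` (`2 ∣` the unit norm
index, `two_dvd_relIndex_unitsNorm_of_not_mem`), then `ord₂ h(K_{n+1}) = ord₂ h(K_n)` — no generation hypothesis, no class group of
`K_n`. [cite: Lang1990, Ch. 13 §4, Lemma 4.1–4.2 and sequel (PDF pp. 203–204)] [cite: Washington1997, §13.3 Prop. 13.22 (proof)] -/
theorem classNumberPExp_succ_eq_two_of_nonNorm_unit_of_not_dvd
    (hs : {w : HeightOneSpectrum (𝓞 (κ.layer n)) |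
        w.asIdeal.ramificationIdxIn (𝓞 (κ.layer (n + 1))) ≠ 1}.ncard ≤ 2) {x : (κ.layer (n + 1))ˣ}
    (hxE : x ∈ unitsE (κ.layer (n + 1)) ⊓ (unitsIncl (κ.layer n) (κ.layer (n + 1))).range)
    (hxN : x ∉ (⊤ : Subgroup (κ.layer (n + 1))ˣ).map
        (Herbrand.norm (κ.layer (n + 1) ≃ₐ[κ.layer n] κ.layer (n + 1)))) :
    classNumberPExp κ (n + 1) = classNumberPExp κ n := by
  haveI : IsGalois K (κ.layer (n + 1)) := κ.isGalois_layer_holds (n + 1)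
  haveI : IsGalois (κ.layer n) (κ.layer (n + 1)) := IsGalois.tower_top_of_isGalois K _ _
  haveI : NumberField (κ.layer (n + 1)) := NumberField.of_module_finite K (κ.layer (n + 1))
  obtain ⟨k, hk⟩ := two_dvd_relIndex_unitsNorm_of_not_mem (finrank_layer_succ_two κ n) hxE hxN
  refine classNumberPExp_succ_eq_of_pow_dvd_relIndex_mul_of_not_dvd κ hram hK n hn hs ⟨k, ?_⟩
  rw [hk]; ring

/-- **`p = 2`, ONE non-norm unit, along the tower: `e_m = e_n` for all `m ≥ n`** (Fukuda's Thm. 1 (1), tree theorem).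
[cite: Fukuda1994, Thm. 1 (1), p. 264] [cite: Lang1990, Ch. 13 §4, Lemma 4.1–4.2 and sequel (PDF pp. 203–204)] -/
theorem classNumberPExp_eq_of_le_two_of_nonNorm_unit_of_not_dvd
    (hs : {w : HeightOneSpectrum (𝓞 (κ.layer n)) |
        w.asIdeal.ramificationIdxIn (𝓞 (κ.layer (n + 1))) ≠ 1}.ncard ≤ 2) {x : (κ.layer (n + 1))ˣ}
    (hxE : x ∈ unitsE (κ.layer (n + 1)) ⊓ (unitsIncl (κ.layer n) (κ.layer (n + 1))).range)
    (hxN : x ∉ (⊤ : Subgroup (κ.layer (n + 1))ˣ).map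
        (Herbrand.norm (κ.layer (n + 1) ≃ₐ[κ.layer n] κ.layer (n + 1)))) {m : ℕ} (hm : n ≤ m) :
    classNumberPExp κ m = classNumberPExp κ n :=
  fukuda1994_thm1_classNumberPExp_const_of_succ_eq_holds K 2 κ n₀ hram n hn
    (classNumberPExp_succ_eq_two_of_nonNorm_unit_of_not_dvd κ n hram hK hn hs hxE hxN) m hm

/-- **`p = 2`, ONE non-norm unit: `μ = 0` in growth form** (`λ = 0`, `ν = e_n`), with no class group of any layer as input beyond
`2 ∤ h_K`. [cite: Fukuda1994, Thm. 1 (1), p. 264] [cite: Lang1990, Ch. 13 §4, Lemma 4.1–4.2 and sequel (PDF pp. 203–204)] -/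
theorem classicalMuVanishes_two_of_nonNorm_unit_of_not_dvd
    (hs : {w : HeightOneSpectrum (𝓞 (κ.layer n)) |
        w.asIdeal.ramificationIdxIn (𝓞 (κ.layer (n + 1))) ≠ 1}.ncard ≤ 2) {x : (κ.layer (n + 1))ˣ}
    (hxE : x ∈ unitsE (κ.layer (n + 1)) ⊓ (unitsIncl (κ.layer n) (κ.layer (n + 1))).range)
    (hxN : x ∉ (⊤ : Subgroup (κ.layer (n + 1))ˣ).map
        (Herbrand.norm (κ.layer (n + 1) ≃ₐ[κ.layer n] κ.layer (n + 1)))) :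
    ClassicalMuVanishes κ ∧ classicalLambda κ = 0 :=
  ⟨classicalMuVanishes_of_eventually_const κ (c := classNumberPExp κ n) (n₀ := n)
      fun _ hm => classNumberPExp_eq_of_le_two_of_nonNorm_unit_of_not_dvd κ n hram hK hn hs hxE hxN hm,
    classicalLambda_eq_zero_of_eventually_const κ (c := classNumberPExp κ n) (n₀ := n)
      fun _ hm => classNumberPExp_eq_of_le_two_of_nonNorm_unit_of_not_dvd κ n hram hK hn hs hxE hxN hm⟩

/-- **`p = 2`, TWO independent non-norm units: `e_{n+1} = e_n`** (unconditional).  `κ` a `ℤ₂`-extension of `K` with `2 ∤ h_K` and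
Fukuda's index `n₀ ≤ n`; if at most THREE primes of `K_n` ramify in `K_{n+1}` and units `x, y` of `K_n` have `x`, `y`, `xy ∉ N K_{n+1}ˣ`
(`4 ∣` the unit norm index, `four_dvd_relIndex_unitsNorm_of_not_mem`), then `ord₂ h(K_{n+1}) = ord₂ h(K_n)`.
[cite: Lang1990, Ch. 13 §4, Lemma 4.1–4.2 and sequel (PDF pp. 203–204)] [cite: Washington1997, §13.3 Prop. 13.22 (proof)] -/
theorem classNumberPExp_succ_eq_two_of_two_nonNorm_units_of_not_dvd
    (hs : {w : HeightOneSpectrum (𝓞 (κ.layer n)) |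
        w.asIdeal.ramificationIdxIn (𝓞 (κ.layer (n + 1))) ≠ 1}.ncard ≤ 3) {x y : (κ.layer (n + 1))ˣ}
    (hxE : x ∈ unitsE (κ.layer (n + 1)) ⊓ (unitsIncl (κ.layer n) (κ.layer (n + 1))).range)
    (hyE : y ∈ unitsE (κ.layer (n + 1)) ⊓ (unitsIncl (κ.layer n) (κ.layer (n + 1))).range)
    (hxN : x ∉ (⊤ : Subgroup (κ.layer (n + 1))ˣ).map
        (Herbrand.norm (κ.layer (n + 1) ≃ₐ[κ.layer n] κ.layer (n + 1))))
    (hyN : y ∉ (⊤ : Subgroup (κ.layer (n + 1))ˣ).map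
        (Herbrand.norm (κ.layer (n + 1) ≃ₐ[κ.layer n] κ.layer (n + 1))))
    (hxyN : x * y ∉ (⊤ : Subgroup (κ.layer (n + 1))ˣ).map
        (Herbrand.norm (κ.layer (n + 1) ≃ₐ[κ.layer n] κ.layer (n + 1)))) :
    classNumberPExp κ (n + 1) = classNumberPExp κ n := by
  haveI : IsGalois K (κ.layer (n + 1)) := κ.isGalois_layer_holds (n + 1)
  haveI : IsGalois (κ.layer n) (κ.layer (n + 1)) := IsGalois.tower_top_of_isGalois K _ _
  haveI : NumberField (κ.layer (n + 1)) := NumberField.of_module_finite K (κ.layer (n + 1))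
  obtain ⟨k, hk⟩ := four_dvd_relIndex_unitsNorm_of_not_mem (finrank_layer_succ_two κ n) hxE hyE hxN hyN hxyN
  refine classNumberPExp_succ_eq_of_pow_dvd_relIndex_mul_of_not_dvd κ hram hK n hn hs ⟨k, ?_⟩
  rw [hk]; ring

/-- **`p = 2`, TWO independent non-norm units, along the tower: `e_m = e_n` for all `m ≥ n`** (Fukuda's Thm. 1 (1), tree theorem).
[cite: Fukuda1994, Thm. 1 (1), p. 264] [cite: Lang1990, Ch. 13 §4, Lemma 4.1–4.2 and sequel (PDF pp. 203–204)] -/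
theorem classNumberPExp_eq_of_le_two_of_two_nonNorm_units_of_not_dvd
    (hs : {w : HeightOneSpectrum (𝓞 (κ.layer n)) |
        w.asIdeal.ramificationIdxIn (𝓞 (κ.layer (n + 1))) ≠ 1}.ncard ≤ 3) {x y : (κ.layer (n + 1))ˣ}
    (hxE : x ∈ unitsE (κ.layer (n + 1)) ⊓ (unitsIncl (κ.layer n) (κ.layer (n + 1))).range)
    (hyE : y ∈ unitsE (κ.layer (n + 1)) ⊓ (unitsIncl (κ.layer n) (κ.layer (n + 1))).range)
    (hxN : x ∉ (⊤ : Subgroup (κ.layer (n + 1))ˣ).map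
        (Herbrand.norm (κ.layer (n + 1) ≃ₐ[κ.layer n] κ.layer (n + 1))))
    (hyN : y ∉ (⊤ : Subgroup (κ.layer (n + 1))ˣ).map
        (Herbrand.norm (κ.layer (n + 1) ≃ₐ[κ.layer n] κ.layer (n + 1))))
    (hxyN : x * y ∉ (⊤ : Subgroup (κ.layer (n + 1))ˣ).map
        (Herbrand.norm (κ.layer (n + 1) ≃ₐ[κ.layer n] κ.layer (n + 1)))) {m : ℕ} (hm : n ≤ m) :
    classNumberPExp κ m = classNumberPExp κ n :=
  fukuda1994_thm1_classNumberPExp_const_of_succ_eq_holds K 2 κ n₀ hram n hn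
    (classNumberPExp_succ_eq_two_of_two_nonNorm_units_of_not_dvd κ n hram hK hn hs hxE hyE hxN hyN hxyN) m hm

/-- **`p = 2`, TWO independent non-norm units: `μ = 0` (growth form) and `λ = 0`**, with no class group of any layer as input
beyond `2 ∤ h_K`. [cite: Fukuda1994, Thm. 1 (1), p. 264] [cite: Lang1990, Ch. 13 §4, Lemma 4.1–4.2 and sequel (PDF pp. 203–204)] -/
theorem classicalMuVanishes_two_of_two_nonNorm_units_of_not_dvd
    (hs : {w : HeightOneSpectrum (𝓞 (κ.layer n)) |
        w.asIdeal.ramificationIdxIn (𝓞 (κ.layer (n + 1))) ≠ 1}.ncard ≤ 3) {x y : (κ.layer (n + 1))ˣ}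
    (hxE : x ∈ unitsE (κ.layer (n + 1)) ⊓ (unitsIncl (κ.layer n) (κ.layer (n + 1))).range)
    (hyE : y ∈ unitsE (κ.layer (n + 1)) ⊓ (unitsIncl (κ.layer n) (κ.layer (n + 1))).range)
    (hxN : x ∉ (⊤ : Subgroup (κ.layer (n + 1))ˣ).map
        (Herbrand.norm (κ.layer (n + 1) ≃ₐ[κ.layer n] κ.layer (n + 1))))
    (hyN : y ∉ (⊤ : Subgroup (κ.layer (n + 1))ˣ).map
        (Herbrand.norm (κ.layer (n + 1) ≃ₐ[κ.layer n] κ.layer (n + 1))))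
    (hxyN : x * y ∉ (⊤ : Subgroup (κ.layer (n + 1))ˣ).map
        (Herbrand.norm (κ.layer (n + 1) ≃ₐ[κ.layer n] κ.layer (n + 1)))) :
    ClassicalMuVanishes κ ∧ classicalLambda κ = 0 :=
  ⟨classicalMuVanishes_of_eventually_const κ (c := classNumberPExp κ n) (n₀ := n)
      fun _ hm => classNumberPExp_eq_of_le_two_of_two_nonNorm_units_of_not_dvd κ n hram hK hn hs hxE hyE hxN hyN hxyN hm,
    classicalLambda_eq_zero_of_eventually_const κ (c := classNumberPExp κ n) (n₀ := n)
      fun _ hm => classNumberPExp_eq_of_le_two_of_two_nonNorm_units_of_not_dvd κ n hram hK hn hs hxE hyE hxN hyN hxyN hm⟩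

end Two

end Literature.NumberTheory.IwasawaTheory

end
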